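import Summits.QuantumFields.YangMills.Theorems.AlphaInputsT3ACv3NewtonLiftTwistedKernel
import Summits.QuantumFields.YangMills.Theorems.AlphaInputsT3ACv3NewtonLiftRegional
import Summits.QuantumFields.YangMills.Theorems.AlphaInputsT3ACv3RelativeGauge
import Summits.QuantumFields.YangMills.Theorems.AlphaInputsT3ACv3FLContractionCore
import HarnessLib

/-!
# `AlphaInputsT3ACv3NewtonLiftGaugeFrames` — STRATEGY B for 2′, the (FL) row under OWNER RULING g24-№4, residual (r1) ∕ (D-cert): **TRANSPORT FRAMES FROM STENCIL GAUGES** — the frames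
# `ψ_σ(b,c′) = Ad(σ_{c′}(b₋)⁻¹·σ_{c′}^{(k)}(c′₋))` built from one fine gauge `σ_{c′}` per coarse bond; their isometry and `𝔰𝔲`-preservation; the EXACT reading of the rotated frame in
# the gauge `σ_c` as `Ad` of the RELATIVE GAUGE `t = σ_cσ_{c′}⁻¹` (`ψ_σ^{σ_c}(b,c′) = Ad(t(b₋)t(ĉ′₋)⁻¹)`); hence `θ ≤ 2·osc(t)` on the read pairs and `θ′ ≤ 2(η_c + η_{c′})` across a
# plaquette from ONE-BOND flatness (this seat's `RelativeGauge.norm_relGauge_tgt_sub_src_le`) — and the two kernel rows of `exists_exact_lift_regional_allL` for ANY twisted kernel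
# `byEntryTw T ψ_σ` in these terms — lane `pub-balaban3d` ∕ cell `ym3-torus`, seat `ym-ust-19936-w4` (g2)

WHY (cell `ym3-torus` 2026-08-28: ★w1-19936 g2 LEAD 02:22:38Z∕03:02:18Z «frames `ψ(b,c) := Ad(σ_c(b₋)⁻¹σ_c(ĉ₋))` from ANY fine gauge σ_c … θ = O(d²Bε), θ′ = η′ automatically»; ★★OWNER g25
03:13Z «the `obLift` certificate (2) comes from ★alpha-2's exactness + port (C)'s pattern re-run over one block»; MAP #3 M19 (D-cert)).  `…NewtonLiftTwistedKernel` (this seat, p600961)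
states rows (ii)∕curl for abstract frames through the ROTATED frames `g(b₋)·ψ b c′(h_{c′}*·Y·h_{c′})·g(b₋)*`; THIS FILE evaluates them for the lane's gauge frames:
* §1 `exists_gaugeFrames` (the frames as `ℝ`-linear maps exist — `LinearMap.mulLeftRight`, no definition needed downstream), `norm_gaugeFrame_eq` (isometry), `gaugeFrame_mem_lieSU`,
  ★★ `rotated_gaugeFrame_eq` (`= Ad(t(b₋)·t^{(k)}(c′₋)⁻¹)`, `t = σ_cσ_{c′}⁻¹`), ★ `norm_rotated_gaugeFrame_sub_le` (`≤ 2‖t(b₋) − t^{(k)}(c′₋)‖·‖Y‖`), ★ `norm_rotated_gaugeFrame_sub_rotated_le`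
  (`≤ 2‖t(b₋) − t(b′₋)‖·‖Y‖`), `norm_relGauge_shift_sub_le` (one bond: `≤ η_c + η_{c′}`).
* §2 ★★★ `hRinv_of_gaugeFrames` — ROW (ii) of (D) for `R₀ = byEntryTw T ψ_σ`: `‖h_c*·Q^{(k)}(σ_c·R₀u·σ_c*)(c)·h_c − u(c)‖ ≤ ((d+1)L^k)·(ρ·(2ω·M))` from the OSCILLATION `ω` of the relative
  gauges `σ_cσ_{c′}⁻¹` between `b₋` and `c′`'s centre over the read pairs (for the one-block `obLift`: `b`, `ĉ′₋` in ONE block — ω = O(dL^k·η) by the drift bound along a block walk);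
  ★★★ `curlRow_of_gaugeFrames` — the CURL ROW of (D)∕(E′) in the gauge `σ_{c₀}` at a plaquette `(x;μ,ν)`: `≤ ρ′·M + 3ρ·(2(η₀′+η′)·M)` from the flatness `η₀′` of `U₀^{σ_{c₀}}` and `η′` of
  every `U₀^{σ_{c′}}` (`c′` in the supports of the four bonds) on the two bonds `(x,μ)`, `(x,ν)` ONLY.
HONEST FRAMING.  Algebra of unitary conjugations over the tree's letters; the gauges, their flatness and the oscillation `ω` are INPUTS ((r1-σ) one-box gauges ★w2 g2; drift ★w4 g0); the
scalar kernel certificate (E)∕(B)∕(C) is ★alpha-2's; (FL)∕`hLift`, the stub 2′χ, the crux and any gap are NOT claimed; count-neutral helper toward R3 2′ (items 19936∕19935); registry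
untouched; nothing about d = 4, the continuum, or a mass gap; YM₃ on T³ is rung R3, not Clay.

References: T. Bałaban, Commun. Math. Phys. 98 (1985) 17–51 [Balaban1985Averaging] ((8)–(13) pp.18–19, (19) p.21); CMP 109 (1987) 249–301 [Balaban1987RG1] ((0.4), (0.11) p.253);
B. C. Hall, Lie Groups, Lie Algebras, and Representations (2015) [Hall2015] (Example 7.3, Prop. 3.16: `Ad` preserves `𝔰𝔲(n)`).
-/

set_option autoImplicit false

noncomputable section

open scoped Matrix.Norms.L2Operator Classical
open NormedSpace
namespace Summit.QuantumFields.YangMills.Theorems.NewtonLiftFramed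

open Literature.MathematicalPhysics.QuantumFieldTheory.Balaban1983to89
open Literature.MathematicalPhysics.QuantumFieldTheory.Balaban1983to89.T4AdjointCovarianceUnitary (lieSU)
open Literature.MathematicalPhysics.QuantumFieldTheory.Balaban1983to89.B5Eq118OneStroke (iterBlockOf)
open T4Continuum
open Summit.QuantumFields.YangMills.Theorems.AbelianEML (linAvgIter curlAt)
open Summit.QuantumFields.YangMills.Theorems.LinearLiftMatrix (byEntryTw linAvgIterM curlM)
open Summit.QuantumFields.YangMills.Theorems.PerturbedPlaquette (norm_conj_SU)
open Summit.QuantumFields.YangMills.Theorems.RelativeGauge (norm_conj_sub_conj_le norm_relGauge_tgt_sub_src_le)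
open Summit.QuantumFields.YangMills.Theorems.Prop7HolRatioPerStep (coe_star_mul_self coe_mul_star_self)
open Summit.QuantumFields.YangMills.Theorems.FLContraction (transfUp_eq_toFine)
open Literature.MathematicalPhysics.QuantumFieldTheory.Balaban1983to89.B10Eq38TorusDomains (toFine)

variable {n : Type*} [Fintype n] [DecidableEq n] {P : Params} {k : ℕ}

/-- The matrix of the inverse of an `SU(n)` element is its adjoint. [folklore] -/
theorem coe_inv_SU (g : Matrix.specialUnitaryGroup n ℂ) : (((g⁻¹ : Matrix.specialUnitaryGroup n ℂ)) : Matrix n n ℂ) = star (g : Matrix n n ℂ) := rfl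

/-- `‖m·Y·m* − Y‖ ≤ 2‖m − 1‖·‖Y‖` for `m ∈ SU(n)`. [cite: Balaban1985Averaging, (19) p.21] -/
theorem norm_conj_sub_self_le [Nonempty n] (m : Matrix.specialUnitaryGroup n ℂ) (Y : Matrix n n ℂ) :
    ‖(m : Matrix n n ℂ) * Y * star (m : Matrix n n ℂ) - Y‖ ≤ 2 * ‖(m : Matrix n n ℂ) - 1‖ * ‖Y‖ := by
  have h := norm_conj_sub_conj_le m 1 Y
  rwa [OneMemClass.coe_one, star_one, one_mul, mul_one] at h

/-- `‖t₁t₀⁻¹ − 1‖ = ‖t₁ − t₀‖` in `SU(n)` (right multiplication by the unitary `t₀*`). [folklore] -/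
theorem norm_coe_mul_inv_sub_one (t₁ t₀ : Matrix.specialUnitaryGroup n ℂ) :
    ‖((t₁ * t₀⁻¹ : Matrix.specialUnitaryGroup n ℂ) : Matrix n n ℂ) - 1‖ = ‖(t₁ : Matrix n n ℂ) - (t₀ : Matrix n n ℂ)‖ := by
  have e : ((t₁ * t₀⁻¹ : Matrix.specialUnitaryGroup n ℂ) : Matrix n n ℂ) - 1 = ((t₁ : Matrix n n ℂ) - (t₀ : Matrix n n ℂ)) * star (t₀ : Matrix n n ℂ) := by
    rw [Submonoid.coe_mul, coe_inv_SU, sub_mul, coe_mul_star_self]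
  rw [e, CStarRing.norm_mul_mem_unitary _ (Unitary.star_mem t₀.2.1)]

/-- `‖t₁t₀⁻¹ − t₂t₀⁻¹‖ = ‖t₁ − t₂‖` in `SU(n)`. [folklore] -/
theorem norm_coe_mul_inv_sub_mul_inv (t₁ t₂ t₀ : Matrix.specialUnitaryGroup n ℂ) :
    ‖((t₁ * t₀⁻¹ : Matrix.specialUnitaryGroup n ℂ) : Matrix n n ℂ) - ((t₂ * t₀⁻¹ : Matrix.specialUnitaryGroup n ℂ) : Matrix n n ℂ)‖ = ‖(t₁ : Matrix n n ℂ) - (t₂ : Matrix n n ℂ)‖ := by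
  have e : ((t₁ * t₀⁻¹ : Matrix.specialUnitaryGroup n ℂ) : Matrix n n ℂ) - ((t₂ * t₀⁻¹ : Matrix.specialUnitaryGroup n ℂ) : Matrix n n ℂ) =
      ((t₁ : Matrix n n ℂ) - (t₂ : Matrix n n ℂ)) * star (t₀ : Matrix n n ℂ) := by
    rw [Submonoid.coe_mul, Submonoid.coe_mul, coe_inv_SU, sub_mul]
  rw [e, CStarRing.norm_mul_mem_unitary _ (Unitary.star_mem t₀.2.1)]

/-- The restricted relative gauge IS the relative gauge at the representative fine site: `g^{(k)}(y)·g′^{(k)}(y)⁻¹ = g(toFine k y)·g′(toFine k y)⁻¹` (so the oscillation letter `ω` of §2 is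
the drift of `t = g·g′⁻¹` between `b₋` and the centre `toFine k c′₋`). [cite: Balaban1985Averaging, (11) p.19] -/
theorem relGauge_transfUp_eq (g g' : GaugeTransf P 0 (Matrix.specialUnitaryGroup n ℂ)) (y : Site P k) :
    transfUp g k y * (transfUp g' k y)⁻¹ = g (toFine k y) * (g' (toFine k y))⁻¹ := by
  rw [transfUp_eq_toFine, transfUp_eq_toFine]

/-! ## §1 The gauge frames and their rotated reading -/

section Frames

variable (σ : PBond P k → GaugeTransf P 0 (Matrix.specialUnitaryGroup n ℂ))

/-- **THE GAUGE FRAMES EXIST AS `ℝ`-LINEAR MAPS**: `ψ_σ(b,c′)Y = σ_{c′}(b₋)*·σ_{c′}^{(k)}(c′₋)·Y·σ_{c′}^{(k)}(c′₋)*·σ_{c′}(b₋)` (`= Ad(σ_{c′}(b₋)⁻¹σ_{c′}^{(k)}(c′₋))`, the transport of the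
`σ_{c′}`-trivial connection from the centre of `c′` to `b₋`). [cite: Balaban1985Averaging, (11)–(13) p.19] -/
theorem exists_gaugeFrames : ∃ ψ : PBond P 0 → PBond P k → Matrix n n ℂ →ₗ[ℝ] Matrix n n ℂ, ∀ (b : PBond P 0) (c' : PBond P k) (Y : Matrix n n ℂ),
    ψ b c' Y = star ((σ c' b.src : Matrix.specialUnitaryGroup n ℂ) : Matrix n n ℂ) * (transfUp (σ c') k c'.src : Matrix n n ℂ) * Y *
      star (transfUp (σ c') k c'.src : Matrix n n ℂ) * (σ c' b.src : Matrix n n ℂ) :=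
  ⟨fun b c' => LinearMap.mulLeftRight ℝ (star ((σ c' b.src : Matrix.specialUnitaryGroup n ℂ) : Matrix n n ℂ) * (transfUp (σ c') k c'.src : Matrix n n ℂ),
      star (transfUp (σ c') k c'.src : Matrix n n ℂ) * (σ c' b.src : Matrix n n ℂ)),
    fun b c' Y => by rw [LinearMap.mulLeftRight_apply]; noncomm_ring⟩

variable (ψ : PBond P 0 → PBond P k → Matrix n n ℂ →ₗ[ℝ] Matrix n n ℂ)
  (hψ : ∀ (b : PBond P 0) (c' : PBond P k) (Y : Matrix n n ℂ),
    ψ b c' Y = star ((σ c' b.src : Matrix.specialUnitaryGroup n ℂ) : Matrix n n ℂ) * (transfUp (σ c') k c'.src : Matrix n n ℂ) * Y *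
      star (transfUp (σ c') k c'.src : Matrix n n ℂ) * (σ c' b.src : Matrix n n ℂ))
include hψ

/-- The gauge frame as ONE conjugation: `ψ_σ(b,c′)Y = m·Y·m*` with `m = σ_{c′}(b₋)⁻¹·σ_{c′}^{(k)}(c′₋) ∈ SU(n)`. [cite: Balaban1985Averaging, (11) p.19] -/
theorem gaugeFrame_eq_conj (b : PBond P 0) (c' : PBond P k) (Y : Matrix n n ℂ) :
    ψ b c' Y = (((σ c' b.src)⁻¹ * transfUp (σ c') k c'.src : Matrix.specialUnitaryGroup n ℂ) : Matrix n n ℂ) * Y *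
      star (((σ c' b.src)⁻¹ * transfUp (σ c') k c'.src : Matrix.specialUnitaryGroup n ℂ) : Matrix n n ℂ) := by
  rw [hψ]
  simp only [Submonoid.coe_mul, coe_inv_SU, star_mul, star_star, mul_assoc]

/-- **ISOMETRY**: `‖ψ_σ(b,c′)Y‖ = ‖Y‖` (so the frames are contractive). [cite: Balaban1985Averaging, (19) p.21] -/
theorem norm_gaugeFrame_eq (b : PBond P 0) (c' : PBond P k) (Y : Matrix n n ℂ) : ‖ψ b c' Y‖ = ‖Y‖ := by
  rw [gaugeFrame_eq_conj σ ψ hψ, norm_conj_SU]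

/-- **`𝔰𝔲(n)`-PRESERVATION**: `ψ_σ(b,c′)` maps `𝔰𝔲(n)` into itself. [cite: Hall2015, Prop. 3.16] -/
theorem gaugeFrame_mem_lieSU (b : PBond P 0) (c' : PBond P k) {Y : Matrix n n ℂ} (hY : Y ∈ lieSU n) : ψ b c' Y ∈ lieSU n := by
  rw [gaugeFrame_eq_conj σ ψ hψ]; exact conj_mem_lieSU' hY _

/-- **★★ THE ROTATED GAUGE FRAME IS `Ad` OF THE RELATIVE GAUGE**: in the gauge `σ_c` (restricted gauge `h_{c′} = σ_c^{(k)}(c′₋)`),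
`σ_c(b₋)·ψ_σ(b,c′)(h_{c′}*·Y·h_{c′})·σ_c(b₋)* = m·Y·m*` with `m = t(b₋)·(t^{(k)}(c′₋))⁻¹`, `t = σ_c·σ_{c′}⁻¹` (fine sites) and `t^{(k)}(c′₋) = σ_c^{(k)}(c′₋)·σ_{c′}^{(k)}(c′₋)⁻¹`.
[cite: Balaban1985Averaging, (8)+(11)–(13) pp.18–19] -/
theorem rotated_gaugeFrame_eq (c : PBond P k) (b : PBond P 0) (c' : PBond P k) (Y : Matrix n n ℂ) :
    ((σ c b.src : Matrix.specialUnitaryGroup n ℂ) : Matrix n n ℂ) * ψ b c' (star (transfUp (σ c) k c'.src : Matrix n n ℂ) * Y * (transfUp (σ c) k c'.src : Matrix n n ℂ)) *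
        star (σ c b.src : Matrix n n ℂ) =
      (((σ c b.src * (σ c' b.src)⁻¹) * (transfUp (σ c) k c'.src * (transfUp (σ c') k c'.src)⁻¹)⁻¹ : Matrix.specialUnitaryGroup n ℂ) : Matrix n n ℂ) * Y *
        star (((σ c b.src * (σ c' b.src)⁻¹) * (transfUp (σ c) k c'.src * (transfUp (σ c') k c'.src)⁻¹)⁻¹ : Matrix.specialUnitaryGroup n ℂ) : Matrix n n ℂ) := by
  rw [hψ]
  simp only [mul_inv_rev, inv_inv, Submonoid.coe_mul, coe_inv_SU, star_mul, star_star, mul_assoc]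

variable [Nonempty n]

/-- **★ THE ROTATED GAUGE FRAME IS `θ`-CLOSE TO THE IDENTITY WITH `θ = 2·‖t(b₋) − t^{(k)}(c′₋)‖`** — the oscillation of the relative gauge `t = σ_cσ_{c′}⁻¹` between `b₋` and the centre
of `c′`. [cite: Balaban1985Averaging, (19) p.21] -/
theorem norm_rotated_gaugeFrame_sub_le (c : PBond P k) (b : PBond P 0) (c' : PBond P k) (Y : Matrix n n ℂ) :
    ‖((σ c b.src : Matrix.specialUnitaryGroup n ℂ) : Matrix n n ℂ) * ψ b c' (star (transfUp (σ c) k c'.src : Matrix n n ℂ) * Y * (transfUp (σ c) k c'.src : Matrix n n ℂ)) *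
          star (σ c b.src : Matrix n n ℂ) - Y‖ ≤
      2 * ‖((σ c b.src * (σ c' b.src)⁻¹ : Matrix.specialUnitaryGroup n ℂ) : Matrix n n ℂ) -
        ((transfUp (σ c) k c'.src * (transfUp (σ c') k c'.src)⁻¹ : Matrix.specialUnitaryGroup n ℂ) : Matrix n n ℂ)‖ * ‖Y‖ := by
  rw [rotated_gaugeFrame_eq σ ψ hψ, ← norm_coe_mul_inv_sub_one]
  exact norm_conj_sub_self_le _ Y

omit [Nonempty n] in
/-- **★ THE ROTATED GAUGE FRAMES AT TWO BONDS DIFFER BY THE RELATIVE GAUGE'S VARIATION BETWEEN THEIR SOURCES**: `‖ψ_σ^{σ_c}(b,c′)Y − ψ_σ^{σ_c}(b′,c′)Y‖ ≤ 2‖t(b₋) − t(b′₋)‖·‖Y‖`.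
[cite: Balaban1985Averaging, (19) p.21] -/
theorem norm_rotated_gaugeFrame_sub_rotated_le (c : PBond P k) (b b' : PBond P 0) (c' : PBond P k) (Y : Matrix n n ℂ) :
    ‖((σ c b.src : Matrix.specialUnitaryGroup n ℂ) : Matrix n n ℂ) * ψ b c' (star (transfUp (σ c) k c'.src : Matrix n n ℂ) * Y * (transfUp (σ c) k c'.src : Matrix n n ℂ)) *
          star (σ c b.src : Matrix n n ℂ) -
        ((σ c b'.src : Matrix.specialUnitaryGroup n ℂ) : Matrix n n ℂ) * ψ b' c' (star (transfUp (σ c) k c'.src : Matrix n n ℂ) * Y * (transfUp (σ c) k c'.src : Matrix n n ℂ)) *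
          star (σ c b'.src : Matrix n n ℂ)‖ ≤
      2 * ‖((σ c b.src * (σ c' b.src)⁻¹ : Matrix.specialUnitaryGroup n ℂ) : Matrix n n ℂ) - ((σ c b'.src * (σ c' b'.src)⁻¹ : Matrix.specialUnitaryGroup n ℂ) : Matrix n n ℂ)‖ * ‖Y‖ := by
  rw [rotated_gaugeFrame_eq σ ψ hψ, rotated_gaugeFrame_eq σ ψ hψ,
    ← norm_coe_mul_inv_sub_mul_inv (σ c b.src * (σ c' b.src)⁻¹) (σ c b'.src * (σ c' b'.src)⁻¹) (transfUp (σ c) k c'.src * (transfUp (σ c') k c'.src)⁻¹)]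
  exact norm_conj_sub_conj_le _ _ Y

omit hψ in
/-- **ONE BOND MOVES THE RELATIVE GAUGE BY THE TWO FLATNESS DEFECTS** (`RelativeGauge.norm_relGauge_tgt_sub_src_le` in this file's letters): for the bond `e`,
`‖t(e₊) − t(e₋)‖ ≤ ‖(U^{σ_c})_e − 1‖ + ‖(U^{σ_{c′}})_e − 1‖`. [cite: Balaban1985Averaging, (8) p.18, (19) p.21] -/
theorem norm_relGauge_shift_sub_le (U : GaugeField P 0 (Matrix.specialUnitaryGroup n ℂ)) (c c' : PBond P k) (e : PBond P 0) :
    ‖((σ c e.tgt * (σ c' e.tgt)⁻¹ : Matrix.specialUnitaryGroup n ℂ) : Matrix n n ℂ) - ((σ c e.src * (σ c' e.src)⁻¹ : Matrix.specialUnitaryGroup n ℂ) : Matrix n n ℂ)‖ ≤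
      ‖((GaugeField.gaugeAct (σ c) U e : Matrix.specialUnitaryGroup n ℂ) : Matrix n n ℂ) - 1‖ + ‖((GaugeField.gaugeAct (σ c') U e : Matrix.specialUnitaryGroup n ℂ) : Matrix n n ℂ) - 1‖ :=
  norm_relGauge_tgt_sub_src_le (σ c) (σ c') U e

end Frames

/-! ## §2 The two kernel rows of the regional lift for gauge frames -/

section Rows

variable [Nonempty n] (T : (PBond P k → ℝ) →ₗ[ℝ] (PBond P 0 → ℝ)) (N : PBond P 0 → PBond P k → Prop) {ρ : ℝ}
  (hB : ∀ (f : PBond P k → ℝ) (M : ℝ) (b : PBond P 0), (∀ c, N b c → |f c| ≤ M) → |T f b| ≤ ρ * M)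
  (σ : PBond P k → GaugeTransf P 0 (Matrix.specialUnitaryGroup n ℂ)) (ψ : PBond P 0 → PBond P k → Matrix n n ℂ →ₗ[ℝ] Matrix n n ℂ)
  (hψ : ∀ (b : PBond P 0) (c' : PBond P k) (Y : Matrix n n ℂ),
    ψ b c' Y = star ((σ c' b.src : Matrix.specialUnitaryGroup n ℂ) : Matrix n n ℂ) * (transfUp (σ c') k c'.src : Matrix n n ℂ) * Y *
      star (transfUp (σ c') k c'.src : Matrix n n ℂ) * (σ c' b.src : Matrix n n ℂ))
include hB hψ

/-- **★★★ ROW (ii) OF THE REGIONAL LIFT FOR GAUGE FRAMES, FROM THE OSCILLATION OF THE RELATIVE GAUGES** (`k ≤ m + K`).  Kernel `T` (exact (E), local sup bound (B) on `N b`), gauges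
`σ`, frames `ψ_σ`; at the constrained bond `c`: if for every finest bond `b` of the two `k`-blocks of `c` and every `c′ ∈ N b` the relative gauge `t = σ_cσ_{c′}⁻¹` satisfies
`‖t(b₋) − t^{(k)}(c′₋)‖ ≤ ω`, then for data `‖u c′‖ ≤ M`: `‖h_c*·Q^{(k)}(b ↦ σ_c(b₋)·(byEntryTw T ψ_σ u)(b)·σ_c(b₋)*)(c)·h_c − u(c)‖ ≤ ((d+1)L^k)·(ρ·((2ω)·M))` — the `hRinv` binder of
`exists_exact_lift_regional_allL` with `κ = 2(d+1)·C·ω` when `ρ = C∕L^k`. [cite: Balaban1985Averaging, (11)–(13) p.19, (19) p.21; Balaban1987RG1, (0.4)+(0.11) p.253] -/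
theorem hRinv_of_gaugeFrames (hk : k ≤ P.m + P.K) (hE : ∀ f, linAvgIter k (T f) = f) (c : PBond P k) (u : PBond P k → Matrix n n ℂ) {M ω : ℝ}
    (hM : ∀ c', ‖u c'‖ ≤ M) (hω : 0 ≤ ω)
    (hosc : ∀ b : PBond P 0, (iterBlockOf k b.src = c.src ∨ iterBlockOf k b.src = c.tgt) → (iterBlockOf k b.tgt = c.src ∨ iterBlockOf k b.tgt = c.tgt) →
      ∀ c' : PBond P k, N b c' →
        ‖((σ c b.src * (σ c' b.src)⁻¹ : Matrix.specialUnitaryGroup n ℂ) : Matrix n n ℂ) -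
          ((transfUp (σ c) k c'.src * (transfUp (σ c') k c'.src)⁻¹ : Matrix.specialUnitaryGroup n ℂ) : Matrix n n ℂ)‖ ≤ ω) :
    ‖star (transfUp (σ c) k c.src : Matrix n n ℂ) *
          linAvgIterM k (fun b => ((σ c b.src : Matrix.specialUnitaryGroup n ℂ) : Matrix n n ℂ) * byEntryTw T ψ u b * star (σ c b.src : Matrix n n ℂ)) c *
          (transfUp (σ c) k c.src : Matrix n n ℂ) - u c‖ ≤ (((P.d : ℝ) + 1) * (P.L : ℝ) ^ k) * (ρ * ((2 * ω) * M)) :=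
  norm_framedAvg_byEntryTw_sub_le T N hB hk hE c ψ (σ c) u hM (by positivity) fun b hb1 hb2 c' hc Y =>
    (norm_rotated_gaugeFrame_sub_le σ ψ hψ c b c' Y).trans (by
      have h := hosc b hb1 hb2 c' hc
      have hY := norm_nonneg Y
      nlinarith)

/-- **★★★ THE CURL ROW OF THE REGIONAL LIFT FOR GAUGE FRAMES, FROM ONE-BOND FLATNESS** at the finest plaquette `(x; μ, ν)` read in the gauge `σ_{c₀}`: kernel `T` with (B) on `N b` and
the local scalar curl bound (C) on `N_c`; if `U₀^{σ_{c₀}}` is `η₀′`-flat and every `U₀^{σ_{c′}}` with `c′` in the supports of the three non-base bonds is `η′`-flat ON THE TWO BONDS `(x,μ)`,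
`(x,ν)`, then for data `‖u c′‖ ≤ M`: `‖curl(b ↦ σ_{c₀}(b₋)·(byEntryTw T ψ_σ u)(b)·σ_{c₀}(b₋)*)(x;μ,ν)‖ ≤ ρ′·M + 3·(ρ·((2(η₀′ + η′))·M))` — the curl-row binder of
`exists_exact_lift_regional_plaq_allL` ∕ `dist1_plaqHol_regional_le`, θ′ = 2(η₀′ + η′) with NO oscillation letter. [cite: Balaban1985Averaging, (8)–(9)+(11) pp.18–19, (19) p.21] -/
theorem curlRow_of_gaugeFrames (Nc : PBond P k → Prop) (x : Site P 0) {μ ν : Fin P.d} {ρ' : ℝ}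
    (hC : ∀ (f : PBond P k → ℝ) (M : ℝ), (∀ c, Nc c → |f c| ≤ M) → |curlAt (T f) x μ ν| ≤ ρ' * M)
    (U₀ : GaugeField P 0 (Matrix.specialUnitaryGroup n ℂ)) (c₀ : PBond P k) (u : PBond P k → Matrix n n ℂ) {M η₀' η' : ℝ} (hM : ∀ c', ‖u c'‖ ≤ M)
    (hη₀' : 0 ≤ η₀') (hη' : 0 ≤ η')
    (hflat₀ : ‖((GaugeField.gaugeAct (σ c₀) U₀ ⟨x, μ⟩ : Matrix.specialUnitaryGroup n ℂ) : Matrix n n ℂ) - 1‖ ≤ η₀' ∧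
      ‖((GaugeField.gaugeAct (σ c₀) U₀ ⟨x, ν⟩ : Matrix.specialUnitaryGroup n ℂ) : Matrix n n ℂ) - 1‖ ≤ η₀')
    (hflat : ∀ b : PBond P 0, (b = ⟨x.shift μ, ν⟩ ∨ b = ⟨x.shift ν, μ⟩ ∨ b = ⟨x, ν⟩) → ∀ c' : PBond P k, N b c' →
      ‖((GaugeField.gaugeAct (σ c') U₀ ⟨x, μ⟩ : Matrix.specialUnitaryGroup n ℂ) : Matrix n n ℂ) - 1‖ ≤ η' ∧
      ‖((GaugeField.gaugeAct (σ c') U₀ ⟨x, ν⟩ : Matrix.specialUnitaryGroup n ℂ) : Matrix n n ℂ) - 1‖ ≤ η') :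
    ‖curlM (fun b => ((σ c₀ b.src : Matrix.specialUnitaryGroup n ℂ) : Matrix n n ℂ) * byEntryTw T ψ u b * star (σ c₀ b.src : Matrix n n ℂ)) x μ ν‖ ≤
      ρ' * M + 3 * (ρ * ((2 * (η₀' + η')) * M)) := by
  refine norm_curlM_conj_byEntryTw_le T N hB Nc x hC ψ (fun b c X => (norm_gaugeFrame_eq σ ψ hψ b c X).le) (σ c₀) u hM (by positivity) fun b hb c' hc Y => ?_
  refine (norm_rotated_gaugeFrame_sub_rotated_le σ ψ hψ c₀ b ⟨x, μ⟩ c' Y).trans ?_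
  have hY := norm_nonneg Y
  obtain ⟨h0μ, h0ν⟩ := hflat₀
  obtain ⟨h'μ, h'ν⟩ := hflat b hb c' hc
  -- the sources of the three other bonds are `x + e_μ`, `x + e_ν`, `x`: one plaquette bond away from `x` (or equal)
  have hvar : ‖((σ c₀ b.src * (σ c' b.src)⁻¹ : Matrix.specialUnitaryGroup n ℂ) : Matrix n n ℂ) -
      ((σ c₀ x * (σ c' x)⁻¹ : Matrix.specialUnitaryGroup n ℂ) : Matrix n n ℂ)‖ ≤ η₀' + η' := by
    rcases hb with e | e | e
    · subst e
      exact (norm_relGauge_shift_sub_le σ U₀ c₀ c' ⟨x, μ⟩).trans (add_le_add h0μ h'μ)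
    · subst e
      exact (norm_relGauge_shift_sub_le σ U₀ c₀ c' ⟨x, ν⟩).trans (add_le_add h0ν h'ν)
    · subst e
      rw [sub_self, norm_zero]; positivity
  have e : (⟨x, μ⟩ : PBond P 0).src = x := rfl
  rw [e]
  nlinarith

end Rows

end Summit.QuantumFields.YangMills.Theorems.NewtonLiftFramed

end
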